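import Literature.MathematicalPhysics.QuantumFieldTheory.ConformalBootstrap3D.PointKernelK34v2Data
import Literature.MathematicalPhysics.QuantumFieldTheory.ConformalBootstrap3D.PointKernelParts

/-!
# K34v2 certificate, kernel part file P11: one-cell head segments 103, 104, 105 in level ranges

The head cells whose kernel evaluation exceeds one `decide` are one-cell segments of `hsegsK34v2`; each is
checked by `PCert.hPartSideOK` (side conditions) and `PCert.hPartOK` per level range `[n_lo, n_lo + count)`
against an integer claim, the claims summing to `≥ 0` (`PointKernel.partsOK`); soundness is
`PCert.hParts_sound` (`PointKernelParts`).  The part files `P1, P2, …` are mutually independent (each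
imports only the data file); the ranges of one cell may span several of them, and the per-cell
conclusions `hparts_i` / `hcell_i` of those cells are assembled in `PointKernelK34v2.lean`.
Estimated kernel time 254 s.
-/

set_option maxRecDepth 100000
set_option maxHeartbeats 0

namespace Literature.MathematicalPhysics.QuantumFieldTheory.ConformalBootstrap3D.PointKernelK34v2

open Literature.MathematicalPhysics.QuantumFieldTheory.ConformalBootstrap3D.PointKernel

/-- levels `[45, 51)` of segment 103: partial lower sum `≥` claim. [folklore] -/
theorem part_103_2 : certK34v2.hPartOK (PCert.segAt hsegsK34v2 103) JHK34v2 45 6 (257160514003467590224834958070982535) = true := by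
  decide +kernel

/-- one-cell segment 104 (row 4, cell `[641/128, 2565/512]`, chord, `n_F = 42`,
2 level ranges): side conditions. [folklore] -/
theorem pside_104 : certK34v2.hPartSideOK (PCert.segAt hsegsK34v2 104) JHK34v2 = true := by
  decide +kernel

/-- its level ranges `(n_lo, count, claim)`. [folklore] -/
def parts_104 : List (ℕ × ℕ × ℤ) := [(0, 33, -1641602394257568509561229198812894447), (33, 10, 1641602394257568509561229198812894448)]

/-- the ranges tile `[0, n_F]` and the claims sum to `≥ 0`. [folklore] -/
theorem pcov_104 : PointKernel.partsOK 42 parts_104 = true := by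
  decide +kernel

/-- levels `[0, 33)` of segment 104: partial lower sum `≥` claim. [folklore] -/
theorem part_104_0 : certK34v2.hPartOK (PCert.segAt hsegsK34v2 104) JHK34v2 0 33 (-1641602394257568509561229198812894447) = true := by
  decide +kernel

/-- levels `[33, 43)` of segment 104: partial lower sum `≥` claim. [folklore] -/
theorem part_104_1 : certK34v2.hPartOK (PCert.segAt hsegsK34v2 104) JHK34v2 33 10 (1641602394257568509561229198812894448) = true := by
  decide +kernel

/-- one-cell segment 105 (row 4, cell `[2565/512, 1283/256]`, chord, `n_F = 42`,
2 level ranges): side conditions. [folklore] -/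
theorem pside_105 : certK34v2.hPartSideOK (PCert.segAt hsegsK34v2 105) JHK34v2 = true := by
  decide +kernel

/-- its level ranges `(n_lo, count, claim)`. [folklore] -/
def parts_105 : List (ℕ × ℕ × ℤ) := [(0, 33, -1497831351138579640876167347054865618), (33, 10, 1497831351138579640876167347054865618)]

/-- the ranges tile `[0, n_F]` and the claims sum to `≥ 0`. [folklore] -/
theorem pcov_105 : PointKernel.partsOK 42 parts_105 = true := by
  decide +kernel

/-- levels `[0, 33)` of segment 105: partial lower sum `≥` claim. [folklore] -/
theorem part_105_0 : certK34v2.hPartOK (PCert.segAt hsegsK34v2 105) JHK34v2 0 33 (-1497831351138579640876167347054865618) = true := by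
  decide +kernel

/-- levels `[33, 43)` of segment 105: partial lower sum `≥` claim. [folklore] -/
theorem part_105_1 : certK34v2.hPartOK (PCert.segAt hsegsK34v2 105) JHK34v2 33 10 (1497831351138579640876167347054865618) = true := by
  decide +kernel

end Literature.MathematicalPhysics.QuantumFieldTheory.ConformalBootstrap3D.PointKernelK34v2
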